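import Literature.Geometry.Lorentzian.TwoParameterFrame
import HarnessLib

/-!
# Curvature along two-parameter maps: `D_t D_s Z − D_s D_t Z = R(x_t, x_s) Z`

O'Neill 1983, Ch. 4, Prop. 44 (2), p. 123: *if `Z` is a vector field on a two-parameter map `x`
into a semi-Riemannian manifold, then `Z_{uv} − Z_{vu} = R(x_u, x_v) Z`* (there `Z_{uv} = (Z_u)_v`
and `R_{XY} = D_{[X,Y]} − [D_X, D_Y]`, Ch. 3, Lemma 35; in the convention of this directory,
`R(X,Y) = ∇_X ∇_Y − ∇_Y ∇_X − ∇_{[X,Y]}` as in `CovariantDerivative.curvatureAux`, the two sign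
differences cancel and the statement reads `D_t D_s Z − D_s D_t Z = R(x_t, x_s) Z`). O'Neill's
proof is one line — "a coordinate computation of `Z_{uv} − Z_{vu}` produces curvature as in
Lemma 3.38" — and this file carries it out, for an arbitrary locally `C¹` covariant derivative
`cov` on the tangent bundle (no metric and no torsion hypothesis are needed), a two-parameter map
`x` which is `C²` at the parameter and a field `Z` with `C²` lift, the partial covariant derivatives
being the `covariantDerivAlong` of `Geodesic.lean`:

* `covariantDerivAlong_covariantDerivAlong_sub_eq_curvature` — **Prop. 4.44 (2)**.

The ingredients, in the trivialisation `e₁` of `TM` at a point `x₁` (fibre maps `A = e₁|_y`, local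
frame `sᵢ`, Christoffel data `Ĉᵢ(y)(A w) = A(∇_w sᵢ)` of `exists_contMDiffOn_christoffel`):

* `mlieBracket_sum_smul_left/right`, `mlieBracket_sum_smul_localFrame_eq_zero` — fields with
  constant components in a chart commute (O'Neill, proof of Prop. 3.36, p. 75: "this is
  accomplished by taking them to have constant components relative to a coordinate system");
* `continuousLinearMapAt_cov_cov_localFrame` — `A(∇_{X₀} ∇_{Ỹ} sᵢ) = (dĈᵢ X₀) v + ∑ⱼ (Ĉᵢ v)ʲ Ĉⱼ u`
  for `Ỹ = ∑ vᵃ sₐ`, `u = A X₀` (the computation `D_{∂ₗ}(∑ Γᵐₖⱼ ∂ₘ) = …` in the proof of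
  Lemma 3.38);
* `continuousLinearMapAt_curvature_localFrame` — **the curvature of a coordinate field in the
  chart**, `A(R(X₀, Y₀) sᵢ) = (dĈᵢ X₀) v − (dĈᵢ Y₀) u + ∑ⱼ ((Ĉᵢ v)ʲ Ĉⱼ u − (Ĉᵢ u)ʲ Ĉⱼ v)`
  (Lemma 3.38, `R(∂ₖ, ∂ₗ)∂ⱼ = ∑ Rⁱⱼₖₗ ∂ᵢ`, in invariant form), from
  `curvature_apply_of_isLocallyContMDiff` on the commuting constant-component extensions;
* `two_parameter_curvature_algebra` — the cancellation of the non-tensorial terms between the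
  coordinate expressions of `D_t D_s Z` and `D_s D_t Z`
  (`continuousLinearMapAt_covariantDerivAlong_covariantDerivAlong` of `TwoParameterFrame.lean`,
  applied to `x` and to the flipped map), using the symmetry of second derivatives of the `C²`
  fibre coordinates and chart expression (`deriv_deriv_comm_of_contDiffAt`).

Everything is proved; there are no definitions and no named facts.

## References

* B. O'Neill, *Semi-Riemannian geometry with applications to relativity*, Academic Press 1983,
  Ch. 3, Lemma 35, Prop. 36, Lemma 38; Ch. 4, pp. 122–123 and Prop. 44 (key `ONeill1983`).
-/

noncomputable section

open Bundle Set Filter VectorField Function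
open scoped Manifold ContDiff Topology

namespace Literature.Geometry.Lorentzian

variable {E : Type*} [NormedAddCommGroup E] [NormedSpace ℝ E] {H : Type*} [TopologicalSpace H]
  {I : ModelWithCorners ℝ E H} {M : Type*} [TopologicalSpace M] [ChartedSpace H M]
  [IsManifold I ∞ M]

/-! ### Constant-coefficient combinations of coordinate fields commute -/

section Bracket

variable [CompleteSpace E] {ι : Type*} [Fintype ι] (b : Module.Basis ι ℝ E) {x₁ y : M}

/-- The bracket is additive and homogeneous in its left slot over finite constant-coefficient
combinations of fields differentiable at the point (Mathlib's `mlieBracket_add_left`,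
`mlieBracket_const_smul_left`, by induction). [folklore] -/
theorem mlieBracket_sum_smul_left {κ : Type*} (S : Finset κ) (c : κ → ℝ)
    {V : κ → Π z : M, TangentSpace I z} (hV : ∀ k ∈ S, MDiffAt (T% (V k)) y)
    (W : Π z : M, TangentSpace I z) :
    mlieBracket I (fun z ↦ ∑ k ∈ S, c k • V k z) W y = ∑ k ∈ S, c k • mlieBracket I (V k) W y := by
  classical
  induction S using Finset.induction_on with
  | empty =>
    simp only [Finset.sum_empty]
    exact congrFun (mlieBracket_zero_left (I := I) (W := W)) y
  | insert a S ha ih =>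
    have hS : ∀ k ∈ S, MDiffAt (T% (V k)) y := fun k hk ↦ hV k (Finset.mem_insert_of_mem hk)
    have ha' : MDiffAt (T% (V a)) y := hV a (Finset.mem_insert_self a S)
    have hfun : (fun z ↦ ∑ k ∈ insert a S, c k • V k z) =
        (c a • V a) + fun z ↦ ∑ k ∈ S, c k • V k z := by
      funext z
      rw [Finset.sum_insert ha]
      rfl
    have hsum : MDiffAt (T% (fun z ↦ ∑ k ∈ S, c k • V k z)) y :=
      MDifferentiableAt.sum_section fun k hk ↦ (hS k hk).smul_const_section (a := c k)
    rw [hfun, mlieBracket_add_left (ha'.smul_const_section (a := c a)) hsum,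
      mlieBracket_const_smul_left ha', ih hS, Finset.sum_insert ha]

/-- The same in the right slot. [folklore] -/
theorem mlieBracket_sum_smul_right {κ : Type*} (S : Finset κ) (c : κ → ℝ)
    (V : Π z : M, TangentSpace I z)
    {W : κ → Π z : M, TangentSpace I z} (hW : ∀ k ∈ S, MDiffAt (T% (W k)) y) :
    mlieBracket I V (fun z ↦ ∑ k ∈ S, c k • W k z) y = ∑ k ∈ S, c k • mlieBracket I V (W k) y := by
  classical
  induction S using Finset.induction_on with
  | empty =>
    simp only [Finset.sum_empty]
    exact congrFun (mlieBracket_zero_right (I := I) (W := V)) y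
  | insert a S ha ih =>
    have hS : ∀ k ∈ S, MDiffAt (T% (W k)) y := fun k hk ↦ hW k (Finset.mem_insert_of_mem hk)
    have ha' : MDiffAt (T% (W a)) y := hW a (Finset.mem_insert_self a S)
    have hfun : (fun z ↦ ∑ k ∈ insert a S, c k • W k z) =
        (c a • W a) + fun z ↦ ∑ k ∈ S, c k • W k z := by
      funext z
      rw [Finset.sum_insert ha]
      rfl
    have hsum : MDiffAt (T% (fun z ↦ ∑ k ∈ S, c k • W k z)) y :=
      MDifferentiableAt.sum_section fun k hk ↦ (hS k hk).smul_const_section (a := c k)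
    rw [hfun, mlieBracket_add_right (ha'.smul_const_section (a := c a)) hsum,
      mlieBracket_const_smul_right ha', ih hS, Finset.sum_insert ha]

/-- **Constant-coefficient combinations of the coordinate fields commute**:
`[∑ₐ cᵃ ∂ₐ, ∑_b dᵇ ∂_b] = ∑ cᵃ dᵇ [∂ₐ, ∂_b] = 0` on the chart domain of `x₁`
(`mlieBracket_localFrame_trivializationAt`) — the extensions "with constant components relative
to a coordinate system", all of whose brackets are zero, of O'Neill 1983, proof of Prop. 3.36,
p. 75. [cite: ONeill1983, Ch. 3, proof of Prop. 36] -/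
theorem mlieBracket_sum_smul_localFrame_eq_zero (hy : y ∈ (chartAt H x₁).source) (c d : ι → ℝ) :
    mlieBracket I (fun z ↦ ∑ a, c a • (trivializationAt E (TangentSpace I) x₁).localFrame b a z)
      (fun z ↦ ∑ a, d a • (trivializationAt E (TangentSpace I) x₁).localFrame b a z) y = 0 := by
  have hs : ∀ a, MDiffAt (T% ((trivializationAt E (TangentSpace I) x₁).localFrame b a)) y :=
    fun a ↦ (contMDiffAt_localFrame_of_mem 1 _ b a (by simpa using hy)).mdifferentiableAt
      one_ne_zero
  rw [mlieBracket_sum_smul_left _ c (fun a _ ↦ hs a)]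
  refine Finset.sum_eq_zero fun a _ ↦ ?_
  rw [mlieBracket_sum_smul_right _ d _ (fun k _ ↦ hs k)]
  refine smul_eq_zero_of_right _ (Finset.sum_eq_zero fun k _ ↦ ?_)
  rw [mlieBracket_localFrame_trivializationAt b hy a k, smul_zero]

end Bracket


/-! ### The curvature of a coordinate field in the chart -/

section CurvatureCoord

variable [FiniteDimensional ℝ E]
  (cov : CovariantDerivative I E (TangentSpace I : M → Type _))
  {ι : Type*} [Fintype ι] (b : Module.Basis ι ℝ E) {x₁ : M}

omit [FiniteDimensional ℝ E] in
/-- A tangent vector at a point of the chart domain is the frame combination with coefficients its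
fibre coordinates: `V₀ = ∑ₐ (A V₀)ᵃ sₐ(p)` (Mathlib's `eq_sum_localFrame_coeff_smul`, the
coefficients read in the trivialisation, `localFrame_coeff_eq_coeff`). [folklore] -/
theorem sum_coord_smul_localFrame_eq {p : M} (hp : p ∈ (chartAt H x₁).source)
    (V₀ : TangentSpace I p) :
    ∑ a, b.coord a ((trivializationAt E (TangentSpace I) x₁).continuousLinearMapAt ℝ p V₀) •
      (trivializationAt E (TangentSpace I) x₁).localFrame b a p = V₀ := by
  have hpe : p ∈ (trivializationAt E (TangentSpace I) x₁).baseSet := by simpa using hp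
  have h := (trivializationAt E (TangentSpace I) x₁).eq_sum_localFrame_coeff_smul (I := I) (b := b)
    (s := fun _ ↦ V₀) hpe
  simp only [(trivializationAt E (TangentSpace I) x₁).localFrame_coeff_eq_coeff (b := b)
    (s := fun _ ↦ V₀) hpe] at h
  rw [← Trivialization.continuousLinearMapAt_apply_of_mem ℝ _ hpe] at h
  simpa only [Module.Basis.coord_apply] using h.symm

/-- **`∇_{X₀} ∇_{Ỹ} sᵢ` in the chart.** Let `e₁` be the trivialisation of `TM` at `x₁`, `sᵢ` its
local frame, `A = e₁|_y` its fibre maps and `Ĉᵢ : M → (E →L[ℝ] E)` the `C¹` Christoffel data of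
a locally `C¹` covariant derivative `∇` (`Ĉᵢ(y)(A w) = A(∇_w sᵢ)` on the chart domain,
`exists_contMDiffOn_christoffel`). For the constant-coefficient field `Ỹ = ∑ₐ vᵃ sₐ` (`A Ỹ ≡ v`)
and a tangent vector `X₀` at a point `p` of the chart domain,
`A(∇_{X₀} (∇_{Ỹ} sᵢ)) = (dĈᵢ(X₀)) v + ∑ⱼ (Ĉᵢ(p) v)ʲ Ĉⱼ(p)(A X₀)`: the field `∇_{Ỹ} sᵢ` reads
`y ↦ Ĉᵢ(y) v` in the chart, so its frame coefficients are `(Ĉᵢ v)ʲ`, and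
`∇_{X₀}(∑ fʲ sⱼ) = ∑ (X₀ fʲ) sⱼ + ∑ fʲ ∇_{X₀} sⱼ` (`cov_apply_eq_sum_localFrame`). This is the
coordinate computation behind `R(∂ₖ, ∂ₗ)∂ⱼ = ∑ᵢ Rⁱⱼₖₗ ∂ᵢ` (O'Neill 1983, Ch. 3, Lemma 38).
[cite: ONeill1983, Ch. 3, Lemma 38] -/
theorem continuousLinearMapAt_cov_cov_localFrame (hcov : cov.IsLocallyContMDiff 1)
    (Ĉ : ι → M → (E →L[ℝ] E))
    (hĈ : ∀ y ∈ (chartAt H x₁).source, ∀ (i) (w : TangentSpace I y),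
      Ĉ i y ((trivializationAt E (TangentSpace I) x₁).continuousLinearMapAt ℝ y w) =
        (trivializationAt E (TangentSpace I) x₁
          ⟨y, cov ((trivializationAt E (TangentSpace I) x₁).localFrame b i) y w⟩).2)
    (hĈs : ∀ i, ContMDiffOn I 𝓘(ℝ, E →L[ℝ] E) 1 (Ĉ i) (chartAt H x₁).source)
    {p : M} (hp : p ∈ (chartAt H x₁).source) (X₀ : TangentSpace I p) (v : E) (i : ι) :
    (trivializationAt E (TangentSpace I) x₁).continuousLinearMapAt ℝ p
        (cov (fun y ↦ cov ((trivializationAt E (TangentSpace I) x₁).localFrame b i) y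
          (∑ a, b.coord a v • (trivializationAt E (TangentSpace I) x₁).localFrame b a y))
          p X₀) =
      (show E →L[ℝ] E from mfderiv I 𝓘(ℝ, E →L[ℝ] E) (Ĉ i) p X₀) v
      + ∑ j, b.coord j (Ĉ i p v) •
          Ĉ j p ((trivializationAt E (TangentSpace I) x₁).continuousLinearMapAt ℝ p X₀) := by
  have hI3 : IsManifold I (minSmoothness ℝ 3) M := by
    rw [minSmoothness_of_isRCLikeNormedField]; infer_instance
  have hpe : p ∈ (trivializationAt E (TangentSpace I) x₁).baseSet := by simpa using hp
  have hsrc : IsOpen (chartAt H x₁).source := (chartAt H x₁).open_source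
  -- smoothness of the frame, of the constant-coefficient field `Ỹ` and of `W = ∇_Ỹ sᵢ`
  have : IsManifold I (2 + 1) M := inferInstanceAs (IsManifold I 3 M)
  have : ContMDiffVectorBundle 2 E (TangentSpace I : M → Type _) I :=
    TangentBundle.contMDiffVectorBundle
  have hs1 : ∀ a : ι,
      CMDiff[(chartAt H x₁).source] 1
        (T% ((trivializationAt E (TangentSpace I) x₁).localFrame b a)) :=
    fun a y hy ↦ (contMDiffAt_localFrame_of_mem 1 _ b a (by simpa using hy)).contMDiffWithinAt
  have hs2 :
      CMDiff[(chartAt H x₁).source] 2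
        (T% ((trivializationAt E (TangentSpace I) x₁).localFrame b i)) :=
    fun y hy ↦ (contMDiffAt_localFrame_of_mem 2 _ b i (by simpa using hy)).contMDiffWithinAt
  have hY : CMDiff[(chartAt H x₁).source] 1
      (T% (fun y ↦ ∑ a, b.coord a v • (trivializationAt E (TangentSpace I) x₁).localFrame b a y)) :=
    ContMDiffOn.sum_section fun a _ ↦ (hs1 a).const_smul_section (a := b.coord a v)
  have hW : MDiffAt (T% (fun y ↦ cov ((trivializationAt E (TangentSpace I) x₁).localFrame b i) y
      (∑ a, b.coord a v • (trivializationAt E (TangentSpace I) x₁).localFrame b a y))) p :=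
    CovariantDerivative.mdifferentiableAt_cov_apply cov hcov hsrc hp hY hs2
  -- values in the chart: `A_y (Ỹ y) = v`, `A_y (W y) = Ĉᵢ(y) v`
  have hAY : ∀ y ∈ (chartAt H x₁).source,
      (trivializationAt E (TangentSpace I) x₁).continuousLinearMapAt ℝ y
        (∑ a, b.coord a v • (trivializationAt E (TangentSpace I) x₁).localFrame b a y) = v :=
      fun y hy ↦ by
    rw [map_sum]
    simp only [map_smul, continuousLinearMapAt_localFrame b hy, Module.Basis.coord_apply]
    exact b.sum_repr v
  have hAW : ∀ y ∈ (chartAt H x₁).source,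
      ((trivializationAt E (TangentSpace I) x₁) ⟨y,
        cov ((trivializationAt E (TangentSpace I) x₁).localFrame b i) y
          (∑ a, b.coord a v • (trivializationAt E (TangentSpace I) x₁).localFrame b a y)⟩).2 =
        Ĉ i y v := fun y hy ↦ by
    rw [← hĈ y hy i, hAY y hy]
  -- the frame coefficients of `W` near `p` are `(Ĉᵢ v)ʲ`
  have hcoef : ∀ j, ∀ y ∈ (chartAt H x₁).source,
      (trivializationAt E (TangentSpace I) x₁).localFrame_coeff I b j y
        (cov ((trivializationAt E (TangentSpace I) x₁).localFrame b i) y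
          (∑ a, b.coord a v • (trivializationAt E (TangentSpace I) x₁).localFrame b a y)) =
        b.coord j (Ĉ i y v) := fun j y hy ↦ by
    have hye : y ∈ (trivializationAt E (TangentSpace I) x₁).baseSet := by simpa using hy
    rw [(trivializationAt E (TangentSpace I) x₁).localFrame_coeff_eq_coeff (b := b)
      (s := fun y ↦ cov ((trivializationAt E (TangentSpace I) x₁).localFrame b i) y
        (∑ a, b.coord a v • (trivializationAt E (TangentSpace I) x₁).localFrame b a y)) hye,
      Module.Basis.coord_apply]
    exact congrArg (fun w : E ↦ b.repr w j) (hAW y hy)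
  -- their derivatives along `X₀` are `((dĈᵢ X₀) v)ʲ`
  have hCd : MDifferentiableAt I 𝓘(ℝ, E →L[ℝ] E) (Ĉ i) p :=
    ((hĈs i).contMDiffAt (hsrc.mem_nhds hp)).mdifferentiableAt one_ne_zero
  have hdcoef : ∀ j, (show ℝ from mfderiv I 𝓘(ℝ, ℝ) (fun y ↦
      (trivializationAt E (TangentSpace I) x₁).localFrame_coeff I b j y
        (cov ((trivializationAt E (TangentSpace I) x₁).localFrame b i) y
          (∑ a, b.coord a v • (trivializationAt E (TangentSpace I) x₁).localFrame b a y))) p X₀) =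
        b.coord j ((show E →L[ℝ] E from mfderiv I 𝓘(ℝ, E →L[ℝ] E) (Ĉ i) p X₀) v) := fun j ↦ by
    have heq : (fun y ↦ (trivializationAt E (TangentSpace I) x₁).localFrame_coeff I b j y
        (cov ((trivializationAt E (TangentSpace I) x₁).localFrame b i) y
          (∑ a, b.coord a v • (trivializationAt E (TangentSpace I) x₁).localFrame b a y))) =ᶠ[𝓝 p]
        fun y ↦ ((b.coord j).toContinuousLinearMap.comp (ContinuousLinearMap.apply ℝ E v))
          (Ĉ i y) := by
      filter_upwards [hsrc.mem_nhds hp] with y hy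
      rw [hcoef j y hy]
      rfl
    have hL := (((b.coord j).toContinuousLinearMap.comp
      (ContinuousLinearMap.apply ℝ E v)).hasMFDerivAt).comp p hCd.hasMFDerivAt
    rw [heq.mfderiv_eq]
    erw [hL.mfderiv]
    rfl
  have hT2 : ∑ j, b.coord j ((show E →L[ℝ] E from mfderiv I 𝓘(ℝ, E →L[ℝ] E) (Ĉ i) p X₀) v) •
      b j = (show E →L[ℝ] E from mfderiv I 𝓘(ℝ, E →L[ℝ] E) (Ĉ i) p X₀) v := by
    simp only [Module.Basis.coord_apply]
    exact b.sum_repr _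
  -- assemble
  rw [cov_apply_eq_sum_localFrame cov (trivializationAt E (TangentSpace I) x₁) b hpe hW X₀, map_sum,
    ← hT2, ← Finset.sum_add_distrib]
  refine Finset.sum_congr rfl fun j _ ↦ ?_
  rw [map_add, map_smul, map_smul, continuousLinearMapAt_localFrame b hp, hĈ p hp j X₀,
    Trivialization.continuousLinearMapAt_apply_of_mem ℝ _ hpe, add_comm, hcoef j p hp]
  congr 1
  exact congrArg (fun r : ℝ ↦ r • b j) (hdcoef j)


/-- **The curvature of the coordinate fields in the chart** (O'Neill 1983, Ch. 3, Lemma 38: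
`R(∂ₖ, ∂ₗ)∂ⱼ = ∑ᵢ Rⁱⱼₖₗ ∂ᵢ` with `Rⁱⱼₖₗ = ∂_k Γⁱₗⱼ − ∂_l Γⁱₖⱼ + Γⁱₖₘ Γᵐₗⱼ − Γⁱₗₘ Γᵐₖⱼ`, in
O'Neill's sign convention `R_{XY} = ∇_{[X,Y]} − [∇_X, ∇_Y]`; ours is the opposite, Lee's,
`R(X,Y) = ∇_X ∇_Y − ∇_Y ∇_X − ∇_{[X,Y]}`, as in `CovariantDerivative.curvatureAux`). With the
notation of `continuousLinearMapAt_cov_cov_localFrame`, for tangent vectors `X₀`, `Y₀` at a point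
`p` of the chart domain, `u = A X₀`, `v = A Y₀`:
`A(R(X₀, Y₀) sᵢ) = (dĈᵢ(X₀)) v − (dĈᵢ(Y₀)) u + ∑ⱼ ((Ĉᵢ v)ʲ Ĉⱼ u − (Ĉᵢ u)ʲ Ĉⱼ v)`.
Proof: evaluate the curvature tensor on the constant-coefficient fields `X̃ = ∑ uᵃ sₐ`,
`Ỹ = ∑ vᵃ sₐ` through `X₀`, `Y₀` (`curvature_apply_of_isLocallyContMDiff`), whose bracket
vanishes (`mlieBracket_sum_smul_localFrame_eq_zero`), and read the two second-order terms in the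
chart (`continuousLinearMapAt_cov_cov_localFrame`). [cite: ONeill1983, Ch. 3, Lemma 38] -/
theorem continuousLinearMapAt_curvature_localFrame [CompleteSpace E]
    (hcov : cov.IsLocallyContMDiff 1) (Ĉ : ι → M → (E →L[ℝ] E))
    (hĈ : ∀ y ∈ (chartAt H x₁).source, ∀ (i) (w : TangentSpace I y),
      Ĉ i y ((trivializationAt E (TangentSpace I) x₁).continuousLinearMapAt ℝ y w) =
        (trivializationAt E (TangentSpace I) x₁
          ⟨y, cov ((trivializationAt E (TangentSpace I) x₁).localFrame b i) y w⟩).2)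
    (hĈs : ∀ i, ContMDiffOn I 𝓘(ℝ, E →L[ℝ] E) 1 (Ĉ i) (chartAt H x₁).source)
    {p : M} (hp : p ∈ (chartAt H x₁).source) (X₀ Y₀ : TangentSpace I p) (i : ι) :
    (trivializationAt E (TangentSpace I) x₁).continuousLinearMapAt ℝ p
        (cov.curvature p X₀ Y₀ ((trivializationAt E (TangentSpace I) x₁).localFrame b i p)) =
      (show E →L[ℝ] E from mfderiv I 𝓘(ℝ, E →L[ℝ] E) (Ĉ i) p X₀)
          ((trivializationAt E (TangentSpace I) x₁).continuousLinearMapAt ℝ p Y₀)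
        - (show E →L[ℝ] E from mfderiv I 𝓘(ℝ, E →L[ℝ] E) (Ĉ i) p Y₀)
          ((trivializationAt E (TangentSpace I) x₁).continuousLinearMapAt ℝ p X₀)
        + ∑ j,
          (b.coord j
                (Ĉ i p ((trivializationAt E (TangentSpace I) x₁).continuousLinearMapAt ℝ p Y₀)) •
              Ĉ j p ((trivializationAt E (TangentSpace I) x₁).continuousLinearMapAt ℝ p X₀)
            - b.coord j
                (Ĉ i p ((trivializationAt E (TangentSpace I) x₁).continuousLinearMapAt ℝ p X₀)) •
              Ĉ j p ((trivializationAt E (TangentSpace I) x₁).continuousLinearMapAt ℝ p Y₀)) := by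
  have hI3 : IsManifold I (minSmoothness ℝ 3) M := by
    rw [minSmoothness_of_isRCLikeNormedField]; infer_instance
  have : IsManifold I (2 + 1) M := inferInstanceAs (IsManifold I 3 M)
  have : ContMDiffVectorBundle 2 E (TangentSpace I : M → Type _) I :=
    TangentBundle.contMDiffVectorBundle
  have hpe : p ∈ (trivializationAt E (TangentSpace I) x₁).baseSet := by simpa using hp
  -- the constant-coefficient fields through `X₀`, `Y₀`
  have hthrough : ∀ V₀ : TangentSpace I p,
      (∑ a, b.coord a ((trivializationAt E (TangentSpace I) x₁).continuousLinearMapAt ℝ p V₀) •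
        (trivializationAt E (TangentSpace I) x₁).localFrame b a p) = V₀ :=
    sum_coord_smul_localFrame_eq b hp
  have hs1 : ∀ a : ι, MDiffAt (T% ((trivializationAt E (TangentSpace I) x₁).localFrame b a)) p :=
    fun a ↦ (contMDiffAt_localFrame_of_mem 1 _ b a hpe).mdifferentiableAt one_ne_zero
  have hfd : ∀ w : E,
      MDiffAt (T% (fun z ↦ ∑ a, b.coord a w •
        (trivializationAt E (TangentSpace I) x₁).localFrame b a z)) p :=
    fun w ↦ MDifferentiableAt.sum_section fun a _ ↦ (hs1 a).smul_const_section (a := b.coord a w)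
  have hZ :
      CMDiffAt (minSmoothness ℝ 2)
        (T% ((trivializationAt E (TangentSpace I) x₁).localFrame b i)) p := by
    rw [minSmoothness_of_isRCLikeNormedField]
    exact contMDiffAt_localFrame_of_mem 2 _ b i hpe
  have hR := CovariantDerivative.curvature_apply_of_isLocallyContMDiff cov hcov
    (hfd ((trivializationAt E (TangentSpace I) x₁).continuousLinearMapAt ℝ p X₀))
    (hfd ((trivializationAt E (TangentSpace I) x₁).continuousLinearMapAt ℝ p Y₀)) hZ
  rw [hthrough X₀, hthrough Y₀] at hR
  rw [hR]
  simp only [CovariantDerivative.curvatureAux]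
  rw [mlieBracket_sum_smul_localFrame_eq_zero b hp, map_zero, sub_zero, map_sub, hthrough X₀,
    hthrough Y₀,
    continuousLinearMapAt_cov_cov_localFrame cov b hcov Ĉ hĈ hĈs hp X₀
      ((trivializationAt E (TangentSpace I) x₁).continuousLinearMapAt ℝ p Y₀) i,
    continuousLinearMapAt_cov_cov_localFrame cov b hcov Ĉ hĈ hĈs hp Y₀
      ((trivializationAt E (TangentSpace I) x₁).continuousLinearMapAt ℝ p X₀) i,
    Finset.sum_sub_distrib]
  abel

end CurvatureCoord


/-! ### Curvature along two-parameter maps -/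

section TwoParameter

omit [IsManifold I ∞ M] in
/-- The bookkeeping identity behind `D_t D_s Z − D_s D_t Z = R(x_t, x_s) Z` in coordinates: with `cⱼ`
the coordinate functionals, `z` the fibre coordinates of `Z`, `zt`, `zs`, `zts` its partial
derivatives, `Pᵢ = Ĉᵢ(∂_s x̂)`, `Qᵢ = Ĉᵢ(∂_t x̂)`, `Dtsᵢ = (dĈᵢ x_t)(∂_s x̂)`,
`Dstᵢ = (dĈᵢ x_s)(∂_t x̂)`, `Tᵢ = Ĉᵢ(∂_t∂_s x̂)`, the difference of the two coordinate expressions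
of `D_t D_s Z` and `D_s D_t Z`
(`continuousLinearMapAt_covariantDerivAlong_covariantDerivAlong`) is `∑ᵢ zⁱ (A R(x_t, x_s) sᵢ)`
(`continuousLinearMapAt_curvature_localFrame`). [folklore] -/
theorem two_parameter_curvature_algebra {ι : Type*} [Fintype ι] {V : Type*} [AddCommGroup V]
    [Module ℝ V] (c : ι → V →ₗ[ℝ] ℝ) (zts zs zt z : V) (P Q Dts Dst T : ι → V) :
    (zts + ∑ i, (c i zt • P i + c i z • Dts i + c i z • T i)
        + ∑ j, c j (zs + ∑ i, c i z • P i) • Q j)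
      - (zts + ∑ i, (c i zs • Q i + c i z • Dst i + c i z • T i)
          + ∑ j, c j (zt + ∑ i, c i z • Q i) • P j) =
      ∑ i, c i z • (Dts i - Dst i + ∑ j, (c j (P i) • Q j - c j (Q i) • P j)) := by
  simp only [map_add, map_sum, map_smul, smul_eq_mul, add_smul, Finset.sum_add_distrib, smul_add,
    smul_sub, Finset.smul_sum, Finset.sum_sub_distrib, smul_smul, Finset.sum_smul]
  rw [Finset.sum_comm (f := fun j i ↦ (c i z * c j (P i)) • Q j),
    Finset.sum_comm (f := fun j i ↦ (c i z * c j (Q i)) • P j)]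
  abel


variable [FiniteDimensional ℝ E] (cov : CovariantDerivative I E (TangentSpace I : M → Type _))

/-- **Curvature along two-parameter maps: `D_t D_s Z − D_s D_t Z = R(x_t, x_s) Z`** (O'Neill 1983,
Ch. 4, Prop. 44 (2), p. 123: `Z_{uv} − Z_{vu} = R(x_u, x_v) Z` with `Z_{uv} = (Z_u)_v` and O'Neill's
sign `R_{XY} = D_{[X,Y]} − [D_X, D_Y]`; Lee, *Riemannian Manifolds*, Prop. 7.5). For a locally `C¹`
covariant derivative `cov` on the tangent bundle (finite-dimensional model), a two-parameter map
`x : ℝ → ℝ → M` which is `C²` at `(t, s)` and a field `Z` along it whose lift to `TM` is `C²` at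
`(t, s)`: the covariant derivative at `t` along the `t`-curve of `t' ↦ (D_s Z)(t', s)`, minus the
covariant derivative at `s` along the `s`-curve of `s' ↦ (D_t Z)(t, s')`, is the curvature tensor
`cov.curvature` on `x_t`, `x_s`, `Z` at `x(t, s)`. Proof as indicated by O'Neill ("a coordinate
computation of `Z_{uv} − Z_{vu}` produces curvature as in Lemma 3.38"): read both second
derivatives in the chart at `x(t, s)`
(`continuousLinearMapAt_covariantDerivAlong_covariantDerivAlong`, for `x` and for the flipped
map), cancel the second partial derivatives of the fibre coordinates
and of the chart expression (Schwarz) and the first-order terms (`two_parameter_curvature_algebra`),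
and recognise `∑ᵢ Zⁱ A(R(x_t, x_s) sᵢ)` (`continuousLinearMapAt_curvature_localFrame`).
[cite: ONeill1983, Ch. 4, Prop. 44 (2)] -/
theorem covariantDerivAlong_covariantDerivAlong_sub_eq_curvature [CompleteSpace E]
    (hcov : cov.IsLocallyContMDiff 1) {x : ℝ → ℝ → M}
    {Z : (t : ℝ) → (s : ℝ) → TangentSpace I (x t s)} {t s : ℝ}
    (hx : ContMDiffAt (𝓘(ℝ, ℝ).prod 𝓘(ℝ, ℝ)) I 2 (uncurry x) (t, s))
    (hZ : ContMDiffAt (𝓘(ℝ, ℝ).prod 𝓘(ℝ, ℝ)) I.tangent 2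
      (fun q : ℝ × ℝ ↦ (TotalSpace.mk' E (x q.1 q.2) (Z q.1 q.2) : TangentBundle I M)) (t, s)) :
    covariantDerivAlong cov (fun t' ↦ x t' s) (fun t' ↦ covariantDerivAlong cov (x t') (Z t') s) t
      - covariantDerivAlong cov (x t)
          (fun s' ↦ covariantDerivAlong cov (fun t' ↦ x t' s') (fun t' ↦ Z t' s') t) s =
      cov.curvature (x t s) (velocity I (fun t' ↦ x t' s) t) (velocity I (x t) s) (Z t s) := by
  set b := Module.finBasis ℝ E
  have hp : x t s ∈ (chartAt H (x t s)).source := mem_chart_source H (x t s)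
  have hpe : x t s ∈ (trivializationAt E (TangentSpace I : M → Type _) (x t s)).baseSet :=
    FiberBundle.mem_baseSet_trivializationAt' (x t s)
  obtain ⟨Ĉ, hĈ, hĈs⟩ := exists_contMDiffOn_christoffel cov hcov b (x t s)
  -- the same data for the map with the parameters exchanged
  have hx' : ContMDiffAt (𝓘(ℝ, ℝ).prod 𝓘(ℝ, ℝ)) I 2 (uncurry (fun s' t' ↦ x t' s')) (s, t) :=
    contMDiffAt_uncurry_flip hx
  have hZ' : ContMDiffAt (𝓘(ℝ, ℝ).prod 𝓘(ℝ, ℝ)) I.tangent 2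
      (fun q : ℝ × ℝ ↦ (TotalSpace.mk' E (x q.2 q.1) (Z q.2 q.1) : TangentBundle I M)) (s, t) :=
    hZ.comp (s, t) (contMDiffAt_snd.prodMk contMDiffAt_fst)
  have T1 := continuousLinearMapAt_covariantDerivAlong_covariantDerivAlong cov b Ĉ hĈ hĈs hp hx hZ
  have T2 := continuousLinearMapAt_covariantDerivAlong_covariantDerivAlong cov b Ĉ hĈ hĈs
    (x := fun s' t' ↦ x t' s') (Z := fun s' t' ↦ Z t' s') (t := s) (s := t) hp hx' hZ'
  -- smoothness bookkeeping: fibre coordinates of `Z` and chart expression of `x`, both flips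
  have hzc2 := contDiffAt_trivializationAt_snd_uncurry hp hZ
  have hzc2' := contDiffAt_trivializationAt_snd_uncurry (x := fun s' t' ↦ x t' s')
    (Z := fun s' t' ↦ Z t' s') hp hZ'
  have hX2 := contDiffAt_extChartAt_uncurry' hp hx
  have hX2' := contDiffAt_extChartAt_uncurry' (x := fun s' t' ↦ x t' s') hp hx'
  have hzcd := hzc2.differentiableAt (by norm_num)
  have hzcd' := hzc2'.differentiableAt (by norm_num)
  -- the flipped atoms agree with the unflipped ones
  have hzts : fderiv ℝ (fderiv ℝ (fun q : ℝ × ℝ ↦ (trivializationAt E (TangentSpace I : M → Type _)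
      (x t s) (TotalSpace.mk' E (x q.2 q.1) (Z q.2 q.1) : TangentBundle I M)).2)) (s, t) (1, 0)
        (0, 1) =
      fderiv ℝ (fderiv ℝ (fun q : ℝ × ℝ ↦ (trivializationAt E (TangentSpace I : M → Type _)
      (x t s) (TotalSpace.mk' E (x q.1 q.2) (Z q.1 q.2) : TangentBundle I M)).2)) (t, s) (1, 0)
        (0, 1) :=
    (deriv_deriv_comm_of_contDiffAt hzc2').2.unique (deriv_deriv_comm_of_contDiffAt hzc2).1
  have hXts : fderiv ℝ (fderiv ℝ (fun q : ℝ × ℝ ↦ extChartAt I (x t s) (x q.2 q.1))) (s, t) (1, 0)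
        (0, 1) =
      fderiv ℝ (fderiv ℝ (fun q : ℝ × ℝ ↦ extChartAt I (x t s) (x q.1 q.2))) (t, s) (1, 0) (0, 1) :=
    (deriv_deriv_comm_of_contDiffAt hX2').2.unique (deriv_deriv_comm_of_contDiffAt hX2).1
  have hzs' : fderiv ℝ (fun q : ℝ × ℝ ↦ (trivializationAt E (TangentSpace I : M → Type _)
      (x t s) (TotalSpace.mk' E (x q.2 q.1) (Z q.2 q.1) : TangentBundle I M)).2) (s, t) (1, 0) =
      fderiv ℝ (fun q : ℝ × ℝ ↦ (trivializationAt E (TangentSpace I : M → Type _)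
      (x t s) (TotalSpace.mk' E (x q.1 q.2) (Z q.1 q.2) : TangentBundle I M)).2) (t, s) (0, 1) :=
    (hasDerivAt_curry_left hzcd').unique (hasDerivAt_curry_right hzcd)
  have hzs_d : deriv (fun s' ↦ (trivializationAt E (TangentSpace I : M → Type _) (x t s)
      (TotalSpace.mk' E (x t s') (Z t s') : TangentBundle I M)).2) s =
      fderiv ℝ (fun q : ℝ × ℝ ↦ (trivializationAt E (TangentSpace I : M → Type _)
      (x t s) (TotalSpace.mk' E (x q.1 q.2) (Z q.1 q.2) : TangentBundle I M)).2) (t, s) (0, 1) :=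
    (hasDerivAt_curry_right hzcd).deriv
  have hzt_d : deriv (fun t' ↦ (trivializationAt E (TangentSpace I : M → Type _) (x t s)
      (TotalSpace.mk' E (x t' s) (Z t' s) : TangentBundle I M)).2) t =
      fderiv ℝ (fun q : ℝ × ℝ ↦ (trivializationAt E (TangentSpace I : M → Type _)
      (x t s) (TotalSpace.mk' E (x q.1 q.2) (Z q.1 q.2) : TangentBundle I M)).2) (t, s) (1, 0) :=
    (hasDerivAt_curry_left hzcd).deriv
  -- the velocities and `Z` in the chart
  have hAt : (trivializationAt E (TangentSpace I : M → Type _) (x t s)).continuousLinearMapAt ℝ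
      (x t s) (velocity I (fun t' ↦ x t' s) t) =
        deriv (fun t' ↦ extChartAt I (x t s) (x t' s)) t := by
    rw [Trivialization.continuousLinearMapAt_apply_of_mem ℝ _ hpe]
    exact trivializationAt_velocity_curry_left (mdifferentiableAt_curry_left hx two_ne_zero) hp
  have hAs : (trivializationAt E (TangentSpace I : M → Type _) (x t s)).continuousLinearMapAt ℝ
      (x t s) (velocity I (fun s' ↦ x t s') s) =
        deriv (fun s' ↦ extChartAt I (x t s) (x t s')) s := by
    rw [Trivialization.continuousLinearMapAt_apply_of_mem ℝ _ hpe]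
    exact trivializationAt_velocity_curry_right (mdifferentiableAt_curry_right hx two_ne_zero) hp
  have hZexp : Z t s = ∑ a, b.coord a ((trivializationAt E (TangentSpace I : M → Type _) (x t s)
      (TotalSpace.mk' E (x t s) (Z t s) : TangentBundle I M)).2) •
        (trivializationAt E (TangentSpace I : M → Type _) (x t s)).localFrame b a (x t s) := by
    rw [← Trivialization.continuousLinearMapAt_apply_of_mem ℝ _ hpe]
    exact (sum_coord_smul_localFrame_eq b hp (Z t s)).symm
  have hR : cov.curvature (x t s) (velocity I (fun t' ↦ x t' s) t) (velocity I (fun s' ↦ x t s') s)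
      (Z t s) = ∑ a, b.coord a ((trivializationAt E (TangentSpace I : M → Type _) (x t s)
      (TotalSpace.mk' E (x t s) (Z t s) : TangentBundle I M)).2) •
        cov.curvature (x t s) (velocity I (fun t' ↦ x t' s) t) (velocity I (fun s' ↦ x t s') s)
          ((trivializationAt E (TangentSpace I : M → Type _) (x t s)).localFrame b a (x t s)) := by
    conv_lhs => rw [hZexp]
    rw [map_sum]
    simp only [map_smul]
  show _ = cov.curvature (x t s) (velocity I (fun t' ↦ x t' s) t) (velocity I (fun s' ↦ x t s') s)
    (Z t s)
  apply ((trivializationAt E (TangentSpace I : M → Type _) (x t s)).continuousLinearEquivAt ℝ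
    (x t s) hpe).injective
  rw [Trivialization.coe_continuousLinearEquivAt_eq, map_sub, T1, T2, hR, map_sum]
  simp only [map_smul, continuousLinearMapAt_curvature_localFrame cov b hcov Ĉ hĈ hĈs hp, hAt, hAs]
  rw [hzts, hXts, hzs', hzs_d, hzt_d]
  exact two_parameter_curvature_algebra (fun j ↦ (b.coord j)) _ _ _ _
    (fun i ↦ Ĉ i (x t s) (deriv (fun s' ↦ extChartAt I (x t s) (x t s')) s))
    (fun i ↦ Ĉ i (x t s) (deriv (fun t' ↦ extChartAt I (x t s) (x t' s)) t))
    (fun i ↦ (show E →L[ℝ] E from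
      mfderiv I 𝓘(ℝ, E →L[ℝ] E) (Ĉ i) (x t s) (velocity I (fun t' ↦ x t' s) t))
        (deriv (fun s' ↦ extChartAt I (x t s) (x t s')) s))
    (fun i ↦ (show E →L[ℝ] E from
      mfderiv I 𝓘(ℝ, E →L[ℝ] E) (Ĉ i) (x t s) (velocity I (fun s' ↦ x t s') s))
        (deriv (fun t' ↦ extChartAt I (x t s) (x t' s)) t))
    (fun i ↦ Ĉ i (x t s) (fderiv ℝ (fderiv ℝ (fun q : ℝ × ℝ ↦ extChartAt I (x t s) (x q.1 q.2)))
      (t, s) (1, 0) (0, 1)))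

end TwoParameter

end Literature.Geometry.Lorentzian

end
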